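import Literature.AnabelianGeometry.EtaleTheta.SettingModelCyclotomicCharacter
import Literature.AnabelianGeometry.EtaleTheta.SettingModel
import Literature.AnabelianGeometry.EtaleTheta.SettingModel2Curve
import Literature.AnabelianGeometry.EtaleTheta.CyclotomeZHatEquiv
import Literature.AnabelianGeometry.EtaleTheta.KummerFieldUnits
import Literature.AnabelianGeometry.EtaleTheta.KummerClass
import Mathlib.GroupTheory.SemidirectProduct
import HarnessLib

/-!
# The Kummer cocycle `κ_q : G_{ℚ_p} → Ẑ` of the model's `q`-parameter `q = p²` for a CHOSEN compatible
# system of roots `(q^{1/N})_N` in `ℚ̄_p`, its cocycle law against the cyclotomic character `χ`, and the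
# affine homomorphism `σ ↦ (κ_q(σ), χ(σ)) : G_{ℚ_p} → Ẑ ⋊ Ẑ^×`
# (R78 cluster of the abc-iut cell, file F3c of abc-iut-L6-d6's R78-MAP #2 (2); STAGE 2 «Tate shear»)

S. Mochizuki, *The étale theta function and its Frobenioid-theoretic manifestations*, Publ. RIMS **45**
(2009) [EtTh], §1 p. 13: "`K_N := K(ζ_N, q_X^{1/N})`", "`G_{K_N}`" — the field cut out by the level-`N`
cyclotomic character AND the level-`N` Kummer class of the `q`-parameter [cite: MochizukiEtTh2009, §1 p.13];
the Kummer cocycle of an element for a compatible system of roots is the tree's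
`RootSystem.kummerCocycle` (`KummerClass.lean`, [LANA2026Report, §6.1 p.31]); J. Neukirch, *Algebraic
Number Theory*, Ch. IV §3 (Kummer theory: `σ ↦ σ(a^{1/n})/a^{1/n}` is a `1`-cocycle with values in `μ_n`,
a homomorphism on `G_{K(μ_n)}`) [cite: NeukirchANT1999, Ch. IV §3].

abc-iut cell, layer L2, seat abc-iut-L2-t5 (gen 5; Tate-curve / Kummer lineage): CLASSICAL INPUT of the
STAGE-2 «Tate shear» upgrade (abc-iut-L2-t6's F-t6g5-2, ADOPTED by abc-iut-L6-d6 R78-MAP #2 (2)) of the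
χ-twisted root model: the Galois action on `(Δ^tp_X)^ell = Ẑ·a ⊕ Ẑ(1)·b` must be the AFFINE action
`θ_{u,k} : a ↦ a·b^k, b ↦ b^u` with `(u, k) = (χ(σ), κ_q(σ))`, and `σ ↦ (χ(σ), κ_q(σ))` is a homomorphism into
`Ẑ ⋊ Ẑ^×` exactly because `κ_q` is a `χ`-cocycle.  CONSTRUCTION + proofs over landed decls only
(abc-iut-w5-d091's `chi` / `chi_spec` / `galUnits` / `levelChar_chi_eq_of_isPrimitiveRoot` /
`apply_eq_pow_levelChar_chi` (F3, `SettingModelCyclotomicCharacter`), abc-iut-L2-t1's `qModel`, `fieldKN`,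
`ZH`, the tree's `cyclotome` / `RootSystem` / `cyclotome.zhatTwist` / `ZHatLevel.level` /
`cyclotome.exists_generator_mulEquiv_zHat_of_isSepClosed`, abc-iut-L2-t11's
`isLocallyConstant_smul_units_of_isAlgebraic`); no instance, no notation, no Prop-valued definition,
nothing of [EtTh] asserted:

* `qUnit p : ℚ̄_pˣ` — `q := qModel p = p²` as a unit, fixed by `G_{ℚ_p}` (`smul_qUnit`); **`qRoots p`** — THE
  CHOSEN compatible system of roots `(q^{1/N})_N` (`RootSystem.ofRootableBy`, `ℚ̄_p` algebraically closed),
  `qRoot p N = q^{1/N} ∈ ℚ̄_p` with `qRoot_pow`, `qRoot_mul_pow`;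
* `kappaCyc p σ ∈ Λ(ℚ̄_pˣ)` — the Kummer cocycle `(σ(q^{1/N}) / q^{1/N})_N` (`= RootSystem.kummerCocycle` at
  `H = ⊤`, `kappaCyc_eq_kummerCocycle`), with `kappaCyc_mul : κ(στ) = κ(σ) · σ•κ(τ)` and
  `smul_cyclotome_eq_zhatTwist : σ • ζ = zhatTwist (χ σ) ζ` on `Λ(ℚ̄_pˣ)`;
* `cycGen p`, **`cycEquiv p : Λ(ℚ̄_pˣ) ≃* Ẑ`** — a CHOSEN generator `ξ` of the cyclotome and the discrete-logarithm
  isomorphism to the base `ξ` (`ξ ↦ η(1)`), with `cycEquiv_zhatTwist : e (zhatTwist u ζ) = u (e ζ)` and hence the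
  `G_{ℚ_p}`-EQUIVARIANCE `cycEquiv_smul : e (σ • ζ) = χ(σ) (e ζ)`;
* **`kappaQ p : GQp p → ZH`**, `κ_q(σ) := e (kappaCyc σ)`, with the COCYCLE LAW
  **`kappaQ_mul : κ_q(στ) = κ_q(σ) · χ(σ)(κ_q(τ))`**, `kappaQ_one`, the defining formula
  `apply_qRoot : σ(q^{1/N}) = ξ_N ^ (κ_q(σ) mod N) · q^{1/N}`, the level-`N` kernel
  **`level_kappaQ_eq_one_iff : level N (κ_q σ) = 1 ↔ σ (q^{1/N}) = q^{1/N}`**, LOCAL CONSTANCY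
  `isLocallyConstant_level_kappaQ` (Krull topology) and `isOpen_setOf_level_kappaQ_eq_one`;
* **`mem_fixingSubgroup_fieldKN_iff : σ ∈ G_{K_N} ↔ χ_N(σ) = 1 ∧ κ_q(σ) ≡ 0 (N)`** for
  `K_N = ℚ_p(μ_N, q^{1/N})` (`fieldKN ⊥ (qModel p) N`) — "this is WHY print's `K_N` is that field" — and, as a
  by-product with NO finite-dimensionality input, `isOpen_fixingSubgroup_fieldKN_qModel` (`G_{K_N}` open);
* **`chiAff p : GQp p →* ZH ⋊[MonoidHom.id _] MulAut ZH`**, `σ ↦ ⟨κ_q(σ), χ(σ)⟩` — the affine character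
  (`(k,u)·(k',u') = (k · u(k'), u u')`), `chiAff_left`, `chiAff_right`, `rightHom_comp_chiAff`.

Choices made (and ONLY these): the root system `qRoots p` and the generator `cycGen p` (with its `cycEquiv p`);
changing either changes `κ_q` by a coboundary / a unit of `Ẑ` — consumers should use the names, never the
choices.  A model is consistency evidence only; nothing here bears on [IUTchIII] Cor. 3.12.
-/

noncomputable section

open CategoryTheory ProfiniteGrp ProfiniteGrp.ProfiniteCompletion

namespace Literature.AnabelianGeometry.EtaleTheta.SettingModel

open Literature.AnabelianGeometry.SemiGraphs (GQp)

variable (p : ℕ) [Fact p.Prime]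

/-! ### The unit `q = p²` and the chosen compatible system of roots `q^{1/N}` -/

/-- The model's `q`-parameter `q = p²` as a unit of `ℚ̄_p` (`p² ≠ 0`: the tree's `qModel_ne_zeroχ`, inlined to
keep this file below the χ-coverings in the import graph). [cite: MochizukiEtTh2009, §1 p.13] -/
def qUnit : (PadicAlgCl p)ˣ :=
  Units.mk0 (qModel p) (by
    haveI := charZero_padicAlgCl p
    exact pow_ne_zero 2 (Nat.cast_ne_zero.mpr (Fact.out : p.Prime).ne_zero))

/-- [cite: MochizukiEtTh2009, §1 p.13] -/
@[simp] theorem coe_qUnit : ((qUnit p : (PadicAlgCl p)ˣ) : PadicAlgCl p) = qModel p := rfl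

/-- `q = p² ∈ ℚ_p` is fixed by every `σ ∈ G_{ℚ_p}`. [cite: MochizukiEtTh2009, §1 p.13] -/
theorem apply_qModel (σ : GQp p) : σ (qModel p) = qModel p := by
  simp only [qModel, map_pow, map_natCast]

/-- `σ • q = q` on units. [cite: MochizukiEtTh2009, §1 p.13] -/
theorem smul_qUnit (σ : GQp p) : σ • qUnit p = qUnit p :=
  Units.ext (by rw [AlgEquiv.smul_units_def, Units.coe_map, MonoidHom.coe_coe, coe_qUnit, apply_qModel])

/-- **THE CHOSEN compatible system of roots `(q^{1/N})_{N ≥ 1}` of `q` in `ℚ̄_pˣ`** (`q^{1/1} = q`,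
`(q^{1/NM})^M = q^{1/N}`; exists since `ℚ̄_p` is algebraically closed — the tree's `RootSystem.ofRootableBy`).
"`q_X^{1/N}`" [cite: MochizukiEtTh2009, §1 p.13] -/
def qRoots : RootSystem (qUnit p) := RootSystem.ofRootableBy (qUnit p)

/-- The chosen `N`-th root `q^{1/N} ∈ ℚ̄_p`. [cite: MochizukiEtTh2009, §1 p.13] -/
def qRoot (N : ℕ+) : PadicAlgCl p := (((qRoots p).root N : (PadicAlgCl p)ˣ) : PadicAlgCl p)

/-- [cite: MochizukiEtTh2009, §1 p.13] -/
theorem coe_qRoots_root (N : ℕ+) : (((qRoots p).root N : (PadicAlgCl p)ˣ) : PadicAlgCl p) = qRoot p N := rfl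

/-- `(q^{1/N})^N = q`. [cite: MochizukiEtTh2009, §1 p.13] -/
theorem qRoot_pow (N : ℕ+) : qRoot p N ^ (N : ℕ) = qModel p := by
  have h := congrArg (fun u : (PadicAlgCl p)ˣ => (u : PadicAlgCl p)) ((qRoots p).pow_self N)
  simp only [Units.val_pow_eq_pow_val] at h
  exact h

/-- Compatibility: `(q^{1/NM})^M = q^{1/N}`. [cite: MochizukiEtTh2009, §1 p.13] -/
theorem qRoot_mul_pow (N M : ℕ+) : qRoot p (N * M) ^ (M : ℕ) = qRoot p N := by
  have h := congrArg (fun u : (PadicAlgCl p)ˣ => (u : PadicAlgCl p)) ((qRoots p).root_mul_pow N M)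
  simp only [Units.val_pow_eq_pow_val] at h
  exact h

/-- `q^{1/N} ≠ 0`. [cite: MochizukiEtTh2009, §1 p.13] -/
theorem qRoot_ne_zero (N : ℕ+) : qRoot p N ≠ 0 := ((qRoots p).root N).ne_zero

/-! ### The Kummer cocycle of `q` with values in the cyclotome `Λ(ℚ̄_pˣ)` -/

/-- **The Kummer cocycle of `q` in the cyclotome**: `κ^Λ_q(σ) := (σ(q^{1/N}) / q^{1/N})_{N} ∈ Λ(ℚ̄_pˣ)` — each
component an `N`-th root of unity since `σ` fixes `q`, compatible since the roots are.
[cite: NeukirchANT1999, Ch. IV §3] -/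
def kappaCyc (σ : GQp p) : cyclotome (PadicAlgCl p)ˣ :=
  ⟨fun n => σ • (qRoots p).root n / (qRoots p).root n,
    ⟨fun n => by rw [div_pow, ← smul_pow', (qRoots p).pow_self, smul_qUnit, div_self'],
      fun n m => by rw [div_pow, ← smul_pow', (qRoots p).root_mul_pow]⟩⟩

/-- Components of `kappaCyc`. [cite: NeukirchANT1999, Ch. IV §3] -/
theorem kappaCyc_apply (σ : GQp p) (n : ℕ+) :
    ((kappaCyc p σ : cyclotome (PadicAlgCl p)ˣ) : ℕ+ → (PadicAlgCl p)ˣ) n =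
      σ • (qRoots p).root n / (qRoots p).root n := rfl

/-- Components of `kappaCyc` in the field: `σ(q^{1/N}) / q^{1/N}`. [cite: NeukirchANT1999, Ch. IV §3] -/
theorem coe_kappaCyc_apply (σ : GQp p) (n : ℕ+) :
    ((((kappaCyc p σ : cyclotome (PadicAlgCl p)ˣ) : ℕ+ → (PadicAlgCl p)ˣ) n : (PadicAlgCl p)ˣ) :
      PadicAlgCl p) = σ (qRoot p n) / qRoot p n := by
  rw [kappaCyc_apply, Units.val_div_eq_div_val, AlgEquiv.smul_units_def, Units.coe_map, MonoidHom.coe_coe,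
    coe_qRoots_root]

/-- `kappaCyc` IS the tree's Kummer cocycle `RootSystem.kummerCocycle` of the root system `qRoots p` for the
full group `H = ⊤ ≤ G_{ℚ_p}`. [cite: LANA2026Report, §6.1 p.31] -/
theorem kappaCyc_eq_kummerCocycle (σ : GQp p) :
    kappaCyc p σ = (qRoots p).kummerCocycle (H := (⊤ : Subgroup (GQp p)))
      (fun g => smul_qUnit p (g : GQp p)) ⟨σ, Subgroup.mem_top σ⟩ :=
  Subtype.ext (funext fun _ => rfl)

/-- `κ^Λ_q(1) = 1`. [cite: NeukirchANT1999, Ch. IV §3] -/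
theorem kappaCyc_one : kappaCyc p 1 = 1 :=
  Subtype.ext (funext fun n => by rw [kappaCyc_apply, one_smul, div_self']; rfl)

/-- **The cocycle identity** `κ^Λ_q(στ) = σ • κ^Λ_q(τ) · κ^Λ_q(σ)`. [cite: NeukirchANT1999, Ch. IV §3] -/
theorem kappaCyc_mul' (σ τ : GQp p) : kappaCyc p (σ * τ) = σ • kappaCyc p τ * kappaCyc p σ := by
  refine Subtype.ext (funext fun n => ?_)
  change ((σ * τ) • (qRoots p).root n) / (qRoots p).root n =
    σ • ((τ • (qRoots p).root n) / (qRoots p).root n) * ((σ • (qRoots p).root n) / (qRoots p).root n)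
  rw [mul_smul, smul_div', div_mul_div_cancel]

/-- The cocycle identity, commuted: `κ^Λ_q(στ) = κ^Λ_q(σ) · σ • κ^Λ_q(τ)`. [cite: NeukirchANT1999, Ch. IV §3] -/
theorem kappaCyc_mul (σ τ : GQp p) : kappaCyc p (σ * τ) = kappaCyc p σ * σ • kappaCyc p τ := by
  rw [kappaCyc_mul', mul_comm]

/-- **`G_{ℚ_p}` acts on the cyclotome `Λ(ℚ̄_pˣ)` through the cyclotomic character**: `σ • ζ = χ(σ) · ζ`
(`zhatTwist`), a restatement of F3's `chi_spec`. [cite: MochizukiEtTh2009, §1 p.13] -/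
theorem smul_cyclotome_eq_zhatTwist (σ : GQp p) (ζ : cyclotome (PadicAlgCl p)ˣ) :
    σ • ζ = cyclotome.zhatTwist (PadicAlgCl p)ˣ (chi p σ) ζ := by
  rw [← chi_spec p σ ζ]
  refine Subtype.ext (funext fun n => ?_)
  rw [cyclotome.smul_apply, cyclotome.map_apply, MulEquiv.coe_toMonoidHom, galUnits_apply_eq_smul]

/-! ### A chosen generator of `Λ(ℚ̄_pˣ)` and the discrete-logarithm isomorphism `Λ(ℚ̄_pˣ) ≃* Ẑ` -/

/-- Existence of a generator `ξ` of `Λ(ℚ̄_pˣ)` (every `ξ_n` primitive) together with an isomorphism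
`e : Λ(ℚ̄_pˣ) ≃* Ẑ`, `e ξ = η(1)`, characterised by `ξ_n ^ (level_n (e ζ)) = ζ_n` (the tree's
`cyclotome.exists_generator_mulEquiv_zHat_of_isSepClosed` at `ℚ̄_p`). [cite: RibesZalesskii2010, Thm 2.7.1] -/
theorem exists_cycData :
    ∃ (ξ : cyclotome (PadicAlgCl p)ˣ) (e : cyclotome (PadicAlgCl p)ˣ ≃* ZH),
      (∀ n : ℕ+, IsPrimitiveRoot ((ξ : ℕ+ → (PadicAlgCl p)ˣ) n) (n : ℕ)) ∧ e ξ = ZHatLevel.eta 1 ∧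
      ∀ (ζ : cyclotome (PadicAlgCl p)ˣ) (n : ℕ+),
        (ξ : ℕ+ → (PadicAlgCl p)ˣ) n ^ (Multiplicative.toAdd (ZHatLevel.level n (e ζ))).val =
          (ζ : ℕ+ → (PadicAlgCl p)ˣ) n := by
  haveI := charZero_padicAlgCl p
  exact cyclotome.exists_generator_mulEquiv_zHat_of_isSepClosed (PadicAlgCl p)

/-- **A CHOSEN generator `ξ = (ξ_n)_n` of the cyclotome `Λ(ℚ̄_pˣ)`** (every `ξ_n` a primitive `n`-th root of
unity, `ξ_{nm}^m = ξ_n`). [cite: RibesZalesskii2010, Thm 2.7.1] -/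
def cycGen : cyclotome (PadicAlgCl p)ˣ := (exists_cycData p).choose

/-- **The discrete-logarithm isomorphism `e : Λ(ℚ̄_pˣ) ≃* Ẑ` to the base `ξ = cycGen p`** (`e ξ = η(1)`).
[cite: RibesZalesskii2010, Thm 2.7.1] -/
def cycEquiv : cyclotome (PadicAlgCl p)ˣ ≃* ZH := (exists_cycData p).choose_spec.choose

/-- Every component `ξ_n` of the chosen generator is a primitive `n`-th root of unity.
[cite: RibesZalesskii2010, Thm 2.7.1] -/
theorem isPrimitiveRoot_cycGen (n : ℕ+) : IsPrimitiveRoot ((cycGen p : ℕ+ → (PadicAlgCl p)ˣ) n) (n : ℕ) :=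
  (exists_cycData p).choose_spec.choose_spec.1 n

/-- … also as an element of the field. [cite: RibesZalesskii2010, Thm 2.7.1] -/
theorem isPrimitiveRoot_coe_cycGen (n : ℕ+) :
    IsPrimitiveRoot (((cycGen p : ℕ+ → (PadicAlgCl p)ˣ) n : (PadicAlgCl p)ˣ) : PadicAlgCl p) (n : ℕ) :=
  (isPrimitiveRoot_cycGen p n).map_of_injective Units.coeHom_injective

/-- `e ξ = η(1)`. [cite: RibesZalesskii2010, Thm 2.7.1] -/
theorem cycEquiv_cycGen : cycEquiv p (cycGen p) = ZHatLevel.eta 1 :=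
  (exists_cycData p).choose_spec.choose_spec.2.1

/-- The discrete-logarithm characterisation: `ξ_n ^ (level_n (e ζ)) = ζ_n`. [cite: RibesZalesskii2010, Thm 2.7.1] -/
theorem cycGen_pow_level (ζ : cyclotome (PadicAlgCl p)ˣ) (n : ℕ+) :
    (cycGen p : ℕ+ → (PadicAlgCl p)ˣ) n ^ (Multiplicative.toAdd (ZHatLevel.level n (cycEquiv p ζ))).val =
      (ζ : ℕ+ → (PadicAlgCl p)ˣ) n :=
  (exists_cycData p).choose_spec.choose_spec.2.2 ζ n

/-- **`level_n (e ζ)` is read off the `n`-th component alone**: `level_n (e ζ) = c ↔ ξ_n ^ c = ζ_n`.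
[cite: RibesZalesskii2010, Thm 2.7.1] -/
theorem level_cycEquiv_eq_iff (ζ : cyclotome (PadicAlgCl p)ˣ) (n : ℕ+) (c : ZMod n) :
    ZHatLevel.level n (cycEquiv p ζ) = Multiplicative.ofAdd c ↔
      (cycGen p : ℕ+ → (PadicAlgCl p)ˣ) n ^ c.val = (ζ : ℕ+ → (PadicAlgCl p)ˣ) n := by
  haveI : NeZero (n : ℕ) := ⟨n.ne_zero⟩
  constructor
  · intro h
    rw [← cycGen_pow_level p ζ n, h, toAdd_ofAdd]
  · intro h
    have h2 := cycGen_pow_level p ζ n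
    rw [← h] at h2
    have hmod := (cyclotome.pow_eq_pow_iff_mod_eq (isPrimitiveRoot_cycGen p n) _ _).mp h2
    rw [Nat.mod_eq_of_lt (ZMod.val_lt _), Nat.mod_eq_of_lt (ZMod.val_lt _)] at hmod
    rw [← ZMod.val_injective n hmod, ofAdd_toAdd]

/-- In particular `level_n (e ζ) = 1 ↔ ζ_n = 1`. [cite: RibesZalesskii2010, Thm 2.7.1] -/
theorem level_cycEquiv_eq_one_iff (ζ : cyclotome (PadicAlgCl p)ˣ) (n : ℕ+) :
    ZHatLevel.level n (cycEquiv p ζ) = 1 ↔ (ζ : ℕ+ → (PadicAlgCl p)ˣ) n = 1 := by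
  rw [← ofAdd_zero, level_cycEquiv_eq_iff, ZMod.val_zero, pow_zero]
  exact eq_comm

/-- **`e` intertwines the `Ẑ^×`-twist with the tautological action**: `e (u · ζ) = u (e ζ)` for `u ∈ Aut(Ẑ)`
(level by level: both sides have level-`n` character `χ_n(u) · level_n (e ζ)`). [cite: RibesZalesskii2010, Thm 2.7.1] -/
theorem cycEquiv_zhatTwist (u : MulAut ZH) (ζ : cyclotome (PadicAlgCl p)ˣ) :
    cycEquiv p (cyclotome.zhatTwist (PadicAlgCl p)ˣ u ζ) = u (cycEquiv p ζ) := by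
  refine ZHatLevel.ext_of_level fun n => ?_
  haveI : NeZero (n : ℕ) := ⟨n.ne_zero⟩
  have hu : ZHatLevel.level n (u (cycEquiv p ζ)) = Multiplicative.ofAdd
      (ZHatLevel.levelChar n u * Multiplicative.toAdd (ZHatLevel.level n (cycEquiv p ζ))) := by
    rw [← ZHatLevel.toAdd_level_aut, ofAdd_toAdd]
  rw [hu, level_cycEquiv_eq_iff, cyclotome.zhatTwist_apply_coe, ← cycGen_pow_level p ζ n, ← pow_mul]
  refine cyclotome.pow_val_eq_pow_of_mod_eq (cyclotome.pow_eq_one (cycGen p) n) ?_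
  rw [ZMod.val_mul, Nat.mod_mod, Nat.mul_comm]

/-- **`G_{ℚ_p}`-EQUIVARIANCE of `e`**: `e (σ • ζ) = χ(σ) (e ζ)` — the identification `Λ(ℚ̄_pˣ) ≅ Ẑ(χ)`.
[cite: MochizukiEtTh2009, §1 p.13] -/
theorem cycEquiv_smul (σ : GQp p) (ζ : cyclotome (PadicAlgCl p)ˣ) :
    cycEquiv p (σ • ζ) = chi p σ (cycEquiv p ζ) := by
  rw [smul_cyclotome_eq_zhatTwist, cycEquiv_zhatTwist]

/-! ### The Kummer cocycle `κ_q : G_{ℚ_p} → Ẑ` -/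

/-- **The Kummer cocycle `κ_q : G_{ℚ_p} → Ẑ` of `q = p²`** for the chosen roots `qRoots p`, read in `Ẑ` through
the chosen `e = cycEquiv p`: `κ_q(σ) := e ((σ(q^{1/N}) / q^{1/N})_N)`. [cite: NeukirchANT1999, Ch. IV §3] -/
def kappaQ (σ : GQp p) : ZH := cycEquiv p (kappaCyc p σ)

/-- [cite: NeukirchANT1999, Ch. IV §3] -/
theorem kappaQ_def (σ : GQp p) : kappaQ p σ = cycEquiv p (kappaCyc p σ) := rfl

/-- `κ_q(1) = 1` (`Ẑ` written multiplicatively). [cite: NeukirchANT1999, Ch. IV §3] -/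
theorem kappaQ_one : kappaQ p 1 = 1 := by
  rw [kappaQ_def, kappaCyc_one, map_one]

/-- **THE COCYCLE LAW** `κ_q(στ) = κ_q(σ) · χ(σ)(κ_q(τ))` (`Ẑ` written multiplicatively; additively:
`κ_q(στ) = κ_q(σ) + χ(σ) κ_q(τ)`). [cite: NeukirchANT1999, Ch. IV §3] -/
theorem kappaQ_mul (σ τ : GQp p) : kappaQ p (σ * τ) = kappaQ p σ * chi p σ (kappaQ p τ) := by
  rw [kappaQ_def, kappaCyc_mul, map_mul, cycEquiv_smul]
  rfl

/-- `κ_q(σ⁻¹) = (χ(σ)⁻¹ (κ_q σ))⁻¹`. [cite: NeukirchANT1999, Ch. IV §3] -/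
theorem kappaQ_inv (σ : GQp p) : kappaQ p σ⁻¹ = ((chi p σ)⁻¹ (kappaQ p σ))⁻¹ := by
  have h := kappaQ_mul p σ⁻¹ σ
  rw [inv_mul_cancel, kappaQ_one, map_inv] at h
  exact eq_inv_of_mul_eq_one_left h.symm

/-- **The defining formula**: `σ(q^{1/N}) = ξ_N ^ (κ_q(σ) mod N) · q^{1/N}` — `σ` moves the chosen root by the
root of unity `ξ_N` raised to the level-`N` shadow of `κ_q(σ)` ("`σ · P₂ = P₂ + κ(σ) P₁`" on the Tate module).
[cite: NeukirchANT1999, Ch. IV §3] -/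
theorem apply_qRoot (σ : GQp p) (N : ℕ+) :
    σ (qRoot p N) = (((cycGen p : ℕ+ → (PadicAlgCl p)ˣ) N : (PadicAlgCl p)ˣ) : PadicAlgCl p) ^
        (Multiplicative.toAdd (ZHatLevel.level N (kappaQ p σ))).val * qRoot p N := by
  have h := congrArg (fun u : (PadicAlgCl p)ˣ => (u : PadicAlgCl p)) (cycGen_pow_level p (kappaCyc p σ) N)
  simp only [Units.val_pow_eq_pow_val] at h
  rw [coe_kappaCyc_apply] at h
  rw [kappaQ_def, h, div_mul_cancel₀ _ (qRoot_ne_zero p N)]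

/-- **The level-`N` kernel**: `κ_q(σ) ≡ 0 (mod N)` iff `σ` FIXES the chosen root `q^{1/N}`.
[cite: MochizukiEtTh2009, §1 p.13] -/
theorem level_kappaQ_eq_one_iff (σ : GQp p) (N : ℕ+) :
    ZHatLevel.level N (kappaQ p σ) = 1 ↔ σ (qRoot p N) = qRoot p N := by
  rw [kappaQ_def, level_cycEquiv_eq_one_iff, kappaCyc_apply, div_eq_one, Units.ext_iff,
    AlgEquiv.smul_units_def, Units.coe_map, MonoidHom.coe_coe, coe_qRoots_root]

/-- Equivalently on units: `level N (κ_q σ) = 1 ↔ σ • q^{1/N} = q^{1/N}`. [cite: MochizukiEtTh2009, §1 p.13] -/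
theorem level_kappaQ_eq_one_iff_smul (σ : GQp p) (N : ℕ+) :
    ZHatLevel.level N (kappaQ p σ) = 1 ↔ σ • (qRoots p).root N = (qRoots p).root N := by
  rw [kappaQ_def, level_cycEquiv_eq_one_iff, kappaCyc_apply, div_eq_one]

/-- **LOCAL CONSTANCY of `σ ↦ κ_q(σ) mod N`** on `G_{ℚ_p}` (Krull topology): it is a function of `σ(q^{1/N})`,
and `σ ↦ σ(q^{1/N})` is locally constant (abc-iut-L2-t11's `isLocallyConstant_smul_units_of_isAlgebraic`).
The continuity input of the STAGE-2 twisted semidirect products. [cite: NeukirchANT1999, Ch. IV §1] -/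
theorem isLocallyConstant_level_kappaQ (N : ℕ+) :
    IsLocallyConstant fun σ : GQp p => ZHatLevel.level N (kappaQ p σ) := by
  classical
  haveI : NeZero (N : ℕ) := ⟨N.ne_zero⟩
  set r : (PadicAlgCl p)ˣ := (qRoots p).root N with hr
  set x : (PadicAlgCl p)ˣ := (cycGen p : ℕ+ → (PadicAlgCl p)ˣ) N with hx
  -- the level is a function of `σ • r`: the discrete logarithm of `σ • r / r` to the base `ξ_N`
  let g : (PadicAlgCl p)ˣ → Multiplicative (ZMod N) := fun y =>
    if h : ∃ c : ZMod N, x ^ c.val = y / r then Multiplicative.ofAdd h.choose else 1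
  have hfun : (fun σ : GQp p => ZHatLevel.level N (kappaQ p σ)) = g ∘ fun σ : GQp p => σ • r := by
    funext σ
    have hex : ∃ c : ZMod N, x ^ c.val = σ • r / r :=
      ⟨Multiplicative.toAdd (ZHatLevel.level N (kappaQ p σ)), by
        rw [hx, hr, ← kappaCyc_apply, kappaQ_def, cycGen_pow_level]⟩
    have hg : g (σ • r) = Multiplicative.ofAdd hex.choose := by
      simp only [g, dif_pos hex]
    rw [Function.comp_apply, hg, kappaQ_def, level_cycEquiv_eq_iff, kappaCyc_apply, ← hr, ← hx]
    exact hex.choose_spec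
  rw [hfun]
  exact (isLocallyConstant_smul_units_of_isAlgebraic r).comp g

/-- The fibres `{σ | κ_q(σ) ≡ c (N)}` are open in `G_{ℚ_p}`. [cite: NeukirchANT1999, Ch. IV §1] -/
theorem isOpen_setOf_level_kappaQ_eq (N : ℕ+) (c : Multiplicative (ZMod N)) :
    IsOpen {σ : GQp p | ZHatLevel.level N (kappaQ p σ) = c} :=
  (isLocallyConstant_level_kappaQ p N).isOpen_fiber c

/-- … in particular the stabiliser `{σ | σ(q^{1/N}) = q^{1/N}} = {σ | κ_q(σ) ≡ 0 (N)}` is open.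
[cite: NeukirchANT1999, Ch. IV §1] -/
theorem isOpen_setOf_level_kappaQ_eq_one (N : ℕ+) :
    IsOpen {σ : GQp p | ZHatLevel.level N (kappaQ p σ) = 1} :=
  isOpen_setOf_level_kappaQ_eq p N 1

/-! ### `G_{K_N} = {χ_N = 1, κ_q ≡ 0 (N)}` for `K_N = ℚ_p(μ_N, q^{1/N})` -/

/-- Every `N`-th root of `q` is `q^{1/N}` times an `N`-th root of unity: if `s^N = q` then `(s / q^{1/N})^N = 1`.
[cite: NeukirchANT1999, Ch. IV §3] -/
theorem div_qRoot_pow_eq_one {N : ℕ+} {s : PadicAlgCl p} (hs : s ^ (N : ℕ) = qModel p) :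
    (s / qRoot p N) ^ (N : ℕ) = 1 := by
  rw [div_pow, hs, qRoot_pow]
  exact div_self (qUnit p).ne_zero

/-- `σ ∈ G_{K_N}` ⇒ `κ_q(σ) ≡ 0 (mod N)` (`q^{1/N} ∈ K_N`). [cite: MochizukiEtTh2009, §1 p.13] -/
theorem level_kappaQ_eq_one_of_mem_fixingSubgroup {σ : GQp p} {N : ℕ+}
    (h : σ ∈ (fieldKN ⊥ (qModel p) N).fixingSubgroup) : ZHatLevel.level N (kappaQ p σ) = 1 := by
  rw [level_kappaQ_eq_one_iff]
  refine (IntermediateField.mem_fixingSubgroup_iff _ _).mp h _ (IntermediateField.subset_adjoin _ _ ?_)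
  exact Set.mem_union_right _ (Or.inr (qRoot_pow p N))

/-- `σ ∈ G_{K_N}` ⇒ `χ_N(σ) = 1` (`μ_N ⊆ K_N`). [cite: MochizukiEtTh2009, §1 p.13] -/
theorem levelChar_chi_eq_one_of_mem_fixingSubgroup {σ : GQp p} {N : ℕ+}
    (h : σ ∈ (fieldKN ⊥ (qModel p) N).fixingSubgroup) : ZHatLevel.levelChar N (chi p σ) = 1 := by
  have hξ := isPrimitiveRoot_coe_cycGen p N
  have hfix : σ (((cycGen p : ℕ+ → (PadicAlgCl p)ˣ) N : (PadicAlgCl p)ˣ) : PadicAlgCl p) =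
      (((cycGen p : ℕ+ → (PadicAlgCl p)ˣ) N : (PadicAlgCl p)ˣ) : PadicAlgCl p) ^ (1 : ℕ) := by
    rw [pow_one]
    refine (IntermediateField.mem_fixingSubgroup_iff _ _).mp h _ (IntermediateField.subset_adjoin _ _ ?_)
    exact Set.mem_union_right _ (Or.inl hξ.pow_eq_one)
  rw [levelChar_chi_eq_of_isPrimitiveRoot p σ N hξ hfix, Nat.cast_one]

/-- If `σ` fixes every element of a set `S`, it fixes the field `ℚ_p(S)` generated by `S`.
[cite: NeukirchANT1999, Ch. IV §1] -/
theorem mem_fixingSubgroup_adjoin_of_forall {σ : GQp p} {S : Set (PadicAlgCl p)} (h : ∀ s ∈ S, σ s = s) :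
    σ ∈ (IntermediateField.adjoin ℚ_[p] S).fixingSubgroup := by
  have hle : Subgroup.zpowers σ ≤ (IntermediateField.adjoin ℚ_[p] S).fixingSubgroup := by
    rw [← IntermediateField.le_iff_le, IntermediateField.adjoin_le_iff]
    intro s hs
    refine (IntermediateField.mem_fixedField_iff _ _).mpr fun τ hτ => ?_
    have hstab : Subgroup.zpowers σ ≤ MulAction.stabilizer (GQp p) s :=
      (Subgroup.zpowers_le).mpr (by rw [MulAction.mem_stabilizer_iff]; exact h s hs)
    exact hstab hτ
  exact hle (Subgroup.mem_zpowers σ)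

/-- **`G_{K_N} = {σ | χ_N(σ) = 1 ∧ κ_q(σ) ≡ 0 (N)}`** for `K_N = ℚ_p(μ_N, q^{1/N})` — the subgroup acting trivially
on `μ_N` AND on the chosen `q^{1/N}`, hence (every `N`-th root of `q` being `q^{1/N}` times a root of unity) on
ALL of `K_N`; "this is why `K_N` is that field". [cite: MochizukiEtTh2009, §1 p.13] -/
theorem mem_fixingSubgroup_fieldKN_iff (σ : GQp p) (N : ℕ+) :
    σ ∈ (fieldKN ⊥ (qModel p) N).fixingSubgroup ↔
      ZHatLevel.levelChar N (chi p σ) = 1 ∧ ZHatLevel.level N (kappaQ p σ) = 1 := by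
  refine ⟨fun h => ⟨levelChar_chi_eq_one_of_mem_fixingSubgroup p h,
    level_kappaQ_eq_one_of_mem_fixingSubgroup p h⟩, fun h => ?_⟩
  obtain ⟨hχ, hκ⟩ := h
  rw [level_kappaQ_eq_one_iff] at hκ
  -- `σ` fixes every `N`-th root of unity
  have hμ : ∀ μ : PadicAlgCl p, μ ^ (N : ℕ) = 1 → σ μ = μ := by
    intro μ hμ
    rw [apply_eq_pow_levelChar_chi p σ N hμ, hχ, ZMod.val_one_eq_one_mod, ← pow_eq_pow_mod 1 hμ, pow_one]
  refine mem_fixingSubgroup_adjoin_of_forall p fun s hs => ?_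
  rcases hs with hs | hs | hs
  · obtain ⟨r, rfl⟩ := IntermediateField.mem_bot.mp hs
    exact σ.commutes r
  · exact hμ s hs
  · -- `s = q^{1/N} · (s / q^{1/N})` with the second factor an `N`-th root of unity
    have hs' : s = qRoot p N * (s / qRoot p N) := by
      rw [← mul_div_assoc, mul_comm, mul_div_assoc, div_self (qRoot_ne_zero p N), mul_one]
    rw [hs', map_mul, hκ, hμ _ (div_qRoot_pow_eq_one p hs)]

/-- **`G_{K_N}` is OPEN in `G_{ℚ_p}`** for `K_N = ℚ_p(μ_N, q^{1/N})` — here with NO finite-dimensionality input: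
it is the intersection of two fibres of locally constant maps (`χ_N`, F3; `κ_q mod N`, above).  (Twin of
abc-iut-L2-t11's `isOpen_fixingSubgroup_fieldKN`, which argues through `[K_N : ℚ_p] < ∞`.)
[cite: MochizukiEtTh2009, §1 p.239 (PDF p.13)] -/
theorem isOpen_fixingSubgroup_fieldKN_qModel (N : ℕ+) :
    IsOpen (((fieldKN ⊥ (qModel p) N).fixingSubgroup : Subgroup (GQp p)) : Set (GQp p)) := by
  have hset : (((fieldKN ⊥ (qModel p) N).fixingSubgroup : Subgroup (GQp p)) : Set (GQp p)) =
      {σ : GQp p | ZHatLevel.levelChar N (chi p σ) = 1} ∩ {σ : GQp p | ZHatLevel.level N (kappaQ p σ) = 1} := by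
    ext σ
    exact mem_fixingSubgroup_fieldKN_iff p σ N
  rw [hset]
  exact (isOpen_setOf_levelChar_chi_eq_one p N).inter (isOpen_setOf_level_kappaQ_eq_one p N)

/-- On `G_{K_N}` the cocycle `κ_q mod N·M`… — usable form for consumers: for `σ, τ ∈ G_{ℚ_p}` with
`χ_N(σ) = 1`, `κ_q mod N` is ADDITIVE: `level N (κ_q(στ)) = level N (κ_q σ) · level N (κ_q τ)` (Kummer theory:
`κ` restricted to `G_{ℚ_p(μ_N)}` is a homomorphism to `μ_N`). [cite: NeukirchANT1999, Ch. IV §3] -/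
theorem level_kappaQ_mul_of_levelChar_eq_one {σ : GQp p} (τ : GQp p) {N : ℕ+}
    (hχ : ZHatLevel.levelChar N (chi p σ) = 1) :
    ZHatLevel.level N (kappaQ p (σ * τ)) = ZHatLevel.level N (kappaQ p σ) * ZHatLevel.level N (kappaQ p τ) := by
  rw [kappaQ_mul, map_mul]
  congr 1
  apply Multiplicative.toAdd.injective
  rw [ZHatLevel.toAdd_level_aut, hχ, one_mul]

/-! ### The affine character `σ ↦ (κ_q(σ), χ(σ)) : G_{ℚ_p} → Ẑ ⋊ Ẑ^×` -/

/-- **The affine character `χ^aff : G_{ℚ_p} →* Ẑ ⋊ Aut(Ẑ)`**, `σ ↦ ⟨κ_q(σ), χ(σ)⟩`, for the tautological action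
of `Aut(Ẑ) = Ẑ^×` on `Ẑ` (multiplication `⟨k, u⟩ · ⟨k', u'⟩ = ⟨k · u(k'), u u'⟩`): a HOMOMORPHISM exactly by the
cocycle law `kappaQ_mul`.  Its image is the affine group through which `G_{ℚ_p}` acts on the Tate module of the
Tate curve `E_q` (upper-triangular `(χ κ_q; 0 1)`). [cite: MochizukiEtTh2009, §1 p.13] -/
def chiAff : GQp p →* ZH ⋊[MonoidHom.id (MulAut ZH)] MulAut ZH where
  toFun σ := ⟨kappaQ p σ, chi p σ⟩
  map_one' := by
    ext
    · rw [kappaQ_one, SemidirectProduct.one_left]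
    · rw [map_one, SemidirectProduct.one_right]
  map_mul' σ τ := by
    ext
    · rw [SemidirectProduct.mul_left, kappaQ_mul, MonoidHom.id_apply]
    · rw [SemidirectProduct.mul_right, map_mul]

/-- `(χ^aff σ).left = κ_q(σ)`. [cite: MochizukiEtTh2009, §1 p.13] -/
@[simp] theorem chiAff_left (σ : GQp p) : (chiAff p σ).left = kappaQ p σ := rfl

/-- `(χ^aff σ).right = χ(σ)`. [cite: MochizukiEtTh2009, §1 p.13] -/
@[simp] theorem chiAff_right (σ : GQp p) : (chiAff p σ).right = chi p σ := rfl

/-- The projection to `Aut(Ẑ)` recovers the cyclotomic character: `rightHom ∘ χ^aff = χ`.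
[cite: MochizukiEtTh2009, §1 p.13] -/
theorem rightHom_comp_chiAff : SemidirectProduct.rightHom.comp (chiAff p) = chi p :=
  MonoidHom.ext fun _ => rfl

/-- `χ^aff σ = inl (κ_q σ) · inr (χ σ)`. [cite: MochizukiEtTh2009, §1 p.13] -/
theorem chiAff_eq_inl_mul_inr (σ : GQp p) :
    chiAff p σ = SemidirectProduct.inl (kappaQ p σ) * SemidirectProduct.inr (chi p σ) := by
  ext
  · rw [chiAff_left, SemidirectProduct.mul_left, SemidirectProduct.left_inl, SemidirectProduct.right_inl,
      map_one, SemidirectProduct.left_inr, MulAut.one_apply, mul_one]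
  · rw [chiAff_right, SemidirectProduct.mul_right, SemidirectProduct.right_inl, SemidirectProduct.right_inr,
      one_mul]

end Literature.AnabelianGeometry.EtaleTheta.SettingModel

end
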